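import Literature.NumberTheory.EllipticCurves.TwoIsogenyPointCount
import Summits.BirchSwinnertonDyer.BirchSwinnertonDyer.Theorems.TwoAdicConverseEisensteinCongruenceModFour
import Literature.NumberTheory.EllipticCurves.LutzNagellGeneralWeierstrass
import HarnessLib

/-!
# Route `TwoAdicConverse` (rung S3), crux `OrdLambdaHalfAtTwo` (item 19556), card `mod-four-redei-layer-two`, lemma K0 —
# Part 1: `4 ∣ #V(𝔽)` iff `b` or `a² - 4b` is a square, for `V : y² = x³ + ax² + bx` over a finite field

Cell `bsd-2adic` (run/shared/lean/pub/bsd-2adic/), seat `bsd-2adic-conv-1` (GEN 21). THEOREMS ONLY — no named fact, no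
definition, no axiom, nothing conditional. HONEST FRAMING: an elementary statement about elliptic curves over FINITE fields;
it is the finite-field core of lemma K0 `ModFourTraceOfOneTwoTorsionPoint` of the crux idea
`Cruxes/OrdLambdaHalfAtTwo/Ideas/mod-four-redei-layer-two.md` (pen ruling PEN-PICK-19556-r1 §1(c): «K0/K1 are the candidate
LEMMAS toward the analytic stub of line `gv-mixed-descent-two`»). Nothing about `λ`-invariants, Selmer groups or BSD is
claimed; item 19556 / 19218 stay OPEN; BSD is not proved by any of this. PARTITION (D-0054): none — RANK axis (S3).

**Set-up.** `V` a Weierstrass curve over a field `F` in two-torsion normal form (`IsTwoTorsionNF`: `a₁ = a₃ = a₆ = 0`,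
i.e. `y² = x³ + ax² + bx`, `a = a₂`, `b = a₄`; tree file `IsogenyTwoTorsionProofs`), elliptic (`b ≠ 0`, `a² - 4b ≠ 0`,
`2 ≠ 0`), with its rational point `T = (0,0)` of order `2` (`twoTorsionPoint`). `#V(F) = Nat.card V.toAffine.Point`.

**Statements.**
* §1 (groups): `four_dvd_natCard_of_double_ne_zero` — an element `g` with `2g ≠ 0 = 4g` gives `4 ∣ #M`;
  `exists_two_torsion_or_exists_double` — in a finite abelian group with `4 ∣ #M` and a non-zero `2`-torsion `t`, either
  there is a second non-zero `2`-torsion element or `t = q + q` (Cauchy in the image of doubling).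
* §2 (any field): `some_add_self_eq_zero_iff` (`2P = O ⟺ y = 0`); `four_dvd_natCard_point_of_isSquare_discr` (`a² - 4b`
  a square ⟹ a second point of order `2` ⟹ `4 ∣ #V(F)`); `four_dvd_natCard_point_of_sq_eq` (**halving `T`**: `b = s²`,
  `a + 2s = w²` ⟹ `Q = (s, sw)` has `2Q = T` by the duplication formula `x(2Q)(2y)² = (x² - b)²`, tree `addX_self_mul`);
  conversely `isSquare_discr_of_two_torsion`, `isSquare_a₄_of_double_eq_twoTorsionPoint` (`Q + Q = T ⟹ b = x(Q)²`).
* §3 (finite field): **`four_dvd_natCard_point_iff_isSquare` — `4 ∣ #V(𝔽)` iff `b` is a square or `a² - 4b` is a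
  square** (if `b = s²` and `a² - 4b = (a + 2s)(a - 2s)` is not a square, one of `a ± 2s` is: `quadraticChar` is
  multiplicative).
* §4: square-class bookkeeping `isSquare_sq_mul_iff`, `isSquare_iff_of_mul_eq_sq`.
* §5 (over `ℚ`): `exists_int_eq_four_mul_of_hasRationalTwoTorsionX` — `4·x(P) ∈ ℤ` for a rational point `P` of order `2`
  on a globally minimal model (Knapp Thm. 5.1(b), tree `LutzNagellGeneral.exists_int_eq_four_mul_eight_mul_of_isOfFinAddOrder`).

Part 2 (`TwoAdicConverseModFourTraceOneTwoTorsionPoint`) transports this to `#W̃(𝔽_ℓ) = ℓ + 1 - a_ℓ` for a globally minimal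
`W/ℚ` with ONE rational point of order `2`.

References: A. W. Knapp, *Elliptic Curves*, Math. Notes 40 (1992), Thm. 4.2 (the halving criterion) [Knapp1993];
J. H. Silverman, *The Arithmetic of Elliptic Curves*, GTM 106 (2009), III.2.3(d) (duplication formula), X.4.9
(`y² = x³ + ax² + bx`, `2`-descent via `x ↦ x mod squares`, `T ↦ b`) [SilvermanAEC2009].
-/

set_option linter.dupNamespace false
set_option autoImplicit false

noncomputable section

open scoped Classical
open WeierstrassCurve Literature.NumberTheory.EllipticCurves Literature.NumberTheory.EllipticCurves.Greenberg1999

namespace Summit.BirchSwinnertonDyer.BirchSwinnertonDyer.Theorems.TwoAdicTwistConverse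

/-! ## §1. Group theory -/

section Group
variable {M : Type*} [AddCommGroup M]

/-- An element `g` with `2g ≠ 0` and `4g = 0` has order `4`, so `4 ∣ #M` (Lagrange; `Nat.card`). [folklore] -/
theorem four_dvd_natCard_of_double_ne_zero (g : M) (h2 : g + g ≠ 0) (h4 : (g + g) + (g + g) = 0) :
    4 ∣ Nat.card M := by
  have h4' : 4 • g = 0 := by
    rw [show (4 : ℕ) = 2 + 2 from rfl, add_nsmul, two_nsmul, h4]
  have hdvd : addOrderOf g ∣ 2 ^ 2 := addOrderOf_dvd_iff_nsmul_eq_zero.mpr h4'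
  obtain ⟨k, hk, hk'⟩ := (Nat.dvd_prime_pow Nat.prime_two).mp hdvd
  interval_cases k
  · exfalso
    rw [pow_zero, AddMonoid.addOrderOf_eq_one_iff] at hk'
    exact h2 (by rw [hk', add_zero])
  · exfalso
    have := addOrderOf_nsmul_eq_zero g
    rw [hk', pow_one, two_nsmul] at this
    exact h2 this
  · have h := addOrderOf_dvd_natCard g
    rwa [hk'] at h

/-- In a finite abelian group with `4 ∣ #M` and a non-zero `2`-torsion element `t`: either there is a
SECOND non-zero `2`-torsion element, or `t` is a double (`t = q + q`). (If `M[2] = {0, t}`, the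
doubling map has kernel of order `2`, so its image has even order `#M / 2` and contains an element of
order `2` by Cauchy; that element is `t`.) [folklore] -/
theorem exists_two_torsion_or_exists_double [Finite M] (h4 : 4 ∣ Nat.card M) {t : M} (ht : t ≠ 0)
    (ht2 : t + t = 0) :
    (∃ p : M, p ≠ 0 ∧ p ≠ t ∧ p + p = 0) ∨ ∃ q : M, q + q = t := by
  by_cases h : ∃ p : M, p ≠ 0 ∧ p ≠ t ∧ p + p = 0
  · exact Or.inl h
  right
  push Not at h
  -- the doubling map
  let D : M →+ M := AddMonoidHom.id M + AddMonoidHom.id M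
  have hD : ∀ q, D q = q + q := fun q ↦ rfl
  -- its kernel is `{0, t}`
  have hker : Nat.card D.ker = 2 := by
    rw [Nat.card_eq_two_iff]
    refine ⟨⟨0, D.ker.zero_mem⟩, ⟨t, by rw [AddMonoidHom.mem_ker, hD, ht2]⟩, ?_, ?_⟩
    · intro h0
      exact ht (congrArg Subtype.val h0).symm
    · rw [Set.eq_univ_iff_forall]
      rintro ⟨a, ha⟩
      rw [AddMonoidHom.mem_ker, hD] at ha
      simp only [Set.mem_insert_iff, Set.mem_singleton_iff, Subtype.mk.injEq]
      by_cases ha0 : a = 0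
      · exact Or.inl ha0
      · right
        by_contra hne
        exact h a ha0 hne ha
  -- so the image has order `#M / 2`, which is even
  have hrange : 2 ∣ Nat.card D.range := by
    have h1 := AddSubgroup.card_eq_card_quotient_mul_card_addSubgroup D.ker
    rw [Nat.card_congr (QuotientAddGroup.quotientKerEquivRange D).toEquiv, hker] at h1
    have : 2 * 2 ∣ Nat.card D.range * 2 := by rw [← h1]; exact h4
    exact Nat.dvd_of_mul_dvd_mul_right two_pos this
  -- Cauchy in the image
  haveI : Fact (Nat.Prime 2) := ⟨Nat.prime_two⟩
  obtain ⟨⟨r, q, rfl⟩, hr⟩ := exists_prime_addOrderOf_dvd_card' (G := D.range) 2 hrange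
  refine ⟨q, ?_⟩
  have hr2 : D q + D q = 0 := by
    have := addOrderOf_nsmul_eq_zero (⟨D q, q, rfl⟩ : D.range)
    rw [hr, two_nsmul] at this
    exact congrArg Subtype.val this
  have hr0 : D q ≠ 0 := by
    intro h0
    have : addOrderOf (⟨D q, q, rfl⟩ : D.range) = 1 := by
      rw [AddMonoid.addOrderOf_eq_one_iff]
      exact Subtype.ext h0
    rw [hr] at this
    exact absurd this (by norm_num)
  by_contra hne
  exact h (D q) hr0 hne hr2
end Group

/-! ## §2. Curves in two-torsion normal form `y² = x³ + ax² + bx` over a field -/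

section NF
variable {F : Type*} [Field F] (V : WeierstrassCurve F) [V.IsTwoTorsionNF] [V.IsElliptic]

/-- On `V : y² = x³ + ax² + bx` an affine point `P = (x, y)` satisfies `P + P = O` iff `y = 0`
(`-(x, y) = (x, -y)` and `2 ≠ 0`). Silverman, *AEC*, III.2.3. [folklore] -/
theorem some_add_self_eq_zero_iff {x y : F} (h : V.toAffine.Nonsingular x y) :
    (.some x y h : V.toAffine.Point) + .some x y h = 0 ↔ y = 0 := by
  constructor
  · intro hP
    by_contra hy
    have hy' : y ≠ V.toAffine.negY x y := by
      rw [negY_of_isTwoTorsionNF]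
      intro h'
      have h2 : (2 : F) * y = 0 := by linear_combination h'
      exact hy ((mul_eq_zero.mp h2).resolve_left (two_ne_zero' V))
    rw [Affine.Point.add_self_of_Y_ne hy'] at hP
    exact Affine.Point.some_ne_zero _ hP
  · intro hy
    exact Affine.Point.add_self_of_Y_eq (by rw [negY_of_isTwoTorsionNF, hy, neg_zero])

omit [V.IsElliptic] in
/-- A point `(x, 0)` on `V` has `x = 0` or `x² + ax + b = 0` (`0 = x(x² + ax + b)`). [folklore] -/
theorem eq_zero_or_quadratic_eq_zero_of_y_eq_zero {x y : F} (h : V.toAffine.Nonsingular x y)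
    (hy : y = 0) : x = 0 ∨ x ^ 2 + V.a₂ * x + V.a₄ = 0 := by
  have e := rel_of_nonsingular V h
  rw [hy] at e
  have : x * (x ^ 2 + V.a₂ * x + V.a₄) = 0 := by linear_combination -e
  exact mul_eq_zero.mp this

/-- The affine point with `x = 0` is `T = (0, 0)`. [folklore] -/
theorem some_eq_twoTorsionPoint_of_x_eq_zero {x y : F} (h : V.toAffine.Nonsingular x y)
    (hx : x = 0) : (.some x y h : V.toAffine.Point) = V.twoTorsionPoint := by
  have hy := y_eq_zero_of_x_eq_zero V h hx
  subst hx hy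
  rfl

/-- `T ≠ O`. [folklore] -/
theorem twoTorsionPoint_ne_zero : V.twoTorsionPoint ≠ 0 :=
  Affine.Point.some_ne_zero _

/-- **If `a² - 4b` is a square, `4 ∣ #V(F)`**: with `a² - 4b = s²`, `x₁ = (s - a)/2 ≠ 0` is a root
of `x² + ax + b`, so `(x₁, 0)` is a second rational point of order `2` and `{O, T, (x₁,0), T + (x₁,0)}`
is a Klein four-group (Lagrange). [folklore] -/
theorem four_dvd_natCard_point_of_isSquare_discr (hr : IsSquare (V.a₂ ^ 2 - 4 * V.a₄)) :
    4 ∣ Nat.card V.toAffine.Point := by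
  obtain ⟨s, hs⟩ := hr
  have h2 := two_ne_zero' V
  obtain ⟨x₁, hx₁⟩ : ∃ x₁ : F, 2 * x₁ = s - V.a₂ :=
    ⟨(s - V.a₂) / 2, mul_div_cancel₀ _ h2⟩
  have hroot : x₁ ^ 2 + V.a₂ * x₁ + V.a₄ = 0 := by
    have h4 : (4 : F) ≠ 0 := by
      rw [show (4 : F) = 2 * 2 by norm_num]
      exact mul_ne_zero h2 h2
    apply mul_left_cancel₀ h4
    linear_combination (2 * x₁ + s + V.a₂) * hx₁ - hs
  have hx0 : x₁ ≠ 0 := by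
    intro h0
    rw [h0] at hroot
    exact a₄_ne_zero V (by simpa using hroot)
  have heq : V.toAffine.Equation x₁ 0 := by
    rw [equation_iff_of_isTwoTorsionNF]
    linear_combination -x₁ * hroot
  have hns : V.toAffine.Nonsingular x₁ 0 := (Affine.equation_iff_nonsingular).mp heq
  refine four_dvd_natCard_of_two_torsion_pair (a := V.twoTorsionPoint) (b := .some x₁ 0 hns)
    (twoTorsionPoint_ne_zero V) (Affine.Point.some_ne_zero _) ?_
    (twoTorsionPoint_add_twoTorsionPoint V) ((some_add_self_eq_zero_iff V hns).mpr rfl)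
  intro hT
  rw [twoTorsionPoint, Affine.Point.some.injEq] at hT
  exact hx0 hT.1.symm

/-- **Halving `T`**: if `b = s²` and `a + 2s = w²`, then `Q = (s, sw)` lies on `V` and `2Q = T`
(duplication formula `x(2Q)(2y)² = (x² - b)²`), so `Q` has order `4` — unless `w = 0`, when `Q` is
a second point of order `2`; either way `4 ∣ #V(F)`. (The sign of `s` is free, so this also covers
`a - 2s = w²`.) Silverman, *AEC*, III.2.3(d); Knapp, *Elliptic Curves*, Thm. 4.2. [folklore] -/
theorem four_dvd_natCard_point_of_sq_eq (s w : F) (hs : s ^ 2 = V.a₄) (hw : w ^ 2 = V.a₂ + 2 * s) :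
    4 ∣ Nat.card V.toAffine.Point := by
  have hs0 : s ≠ 0 := by
    intro h0
    apply a₄_ne_zero V
    rw [← hs, h0]
    ring
  have heq : V.toAffine.Equation s (s * w) := by
    rw [equation_iff_of_isTwoTorsionNF, ← hs]
    linear_combination s ^ 2 * hw
  have hns : V.toAffine.Nonsingular s (s * w) := (Affine.equation_iff_nonsingular).mp heq
  have hQT : (.some s (s * w) hns : V.toAffine.Point) ≠ V.twoTorsionPoint := by
    intro h
    rw [twoTorsionPoint, Affine.Point.some.injEq] at h
    exact hs0 h.1
  by_cases hw0 : w = 0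
  · -- `Q` is a second point of order two
    have hy : s * w = 0 := by rw [hw0, mul_zero]
    exact four_dvd_natCard_of_two_torsion_pair (a := V.twoTorsionPoint) (b := .some s (s * w) hns)
      (twoTorsionPoint_ne_zero V) (Affine.Point.some_ne_zero _) (Ne.symm hQT)
      (twoTorsionPoint_add_twoTorsionPoint V) ((some_add_self_eq_zero_iff V hns).mpr hy)
  · -- `Q` has order four: `2Q = T`
    have hy0 : s * w ≠ 0 := mul_ne_zero hs0 hw0
    have hy : s * w ≠ V.toAffine.negY s (s * w) := by
      rw [negY_of_isTwoTorsionNF]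
      intro h'
      have h2 : (2 : F) * (s * w) = 0 := by linear_combination h'
      exact hy0 ((mul_eq_zero.mp h2).resolve_left (two_ne_zero' V))
    have hdup := addX_self_mul V hns hy
    rw [hs, sub_self, zero_pow two_ne_zero, mul_eq_zero] at hdup
    have hX : V.toAffine.addX s s (V.toAffine.slope s s (s * w) (s * w)) = 0 :=
      hdup.resolve_right (pow_ne_zero _ (mul_ne_zero (two_ne_zero' V) hy0))
    have h2Q : (.some s (s * w) hns : V.toAffine.Point) + .some s (s * w) hns = V.twoTorsionPoint := by
      rw [Affine.Point.add_self_of_Y_ne hy]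
      exact some_eq_twoTorsionPoint_of_x_eq_zero V _ hX
    refine four_dvd_natCard_of_double_ne_zero (.some s (s * w) hns) ?_ ?_
    · rw [h2Q]; exact twoTorsionPoint_ne_zero V
    · rw [h2Q]; exact twoTorsionPoint_add_twoTorsionPoint V

/-- **Conversely (any field): a point of order `2` other than `T` makes `a² - 4b` a square**
(`(x, 0)` with `x ≠ 0` a root of `x² + ax + b`, so `a² - 4b = (2x + a)²`). [folklore] -/
theorem isSquare_discr_of_two_torsion {P : V.toAffine.Point} (hP0 : P ≠ 0)
    (hPT : P ≠ V.twoTorsionPoint) (hP2 : P + P = 0) : IsSquare (V.a₂ ^ 2 - 4 * V.a₄) := by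
  rcases P with _ | ⟨x, y, h⟩
  · exact absurd rfl hP0
  have hy := (some_add_self_eq_zero_iff V h).mp hP2
  rcases eq_zero_or_quadratic_eq_zero_of_y_eq_zero V h hy with hx | hq
  · exact absurd (some_eq_twoTorsionPoint_of_x_eq_zero V h hx) hPT
  · exact ⟨2 * x + V.a₂, by linear_combination -4 * hq⟩

/-- **Conversely (any field): if `T` is a double, `b` is a square** (`Q + Q = T` with `Q = (x, y)`
forces `x(2Q) = 0`, and `x(2Q)(2y)² = (x² - b)²` gives `b = x²`). Knapp, *Elliptic Curves*, Thm. 4.2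
(halving criterion). [folklore] -/
theorem isSquare_a₄_of_double_eq_twoTorsionPoint {Q : V.toAffine.Point}
    (hQ : Q + Q = V.twoTorsionPoint) : IsSquare V.a₄ := by
  rcases Q with _ | ⟨x, y, h⟩
  · exact absurd hQ (by rw [← Affine.Point.zero_def, add_zero]; exact (twoTorsionPoint_ne_zero V).symm)
  have hy : y ≠ V.toAffine.negY x y := by
    intro h'
    rw [Affine.Point.add_self_of_Y_eq h'] at hQ
    exact twoTorsionPoint_ne_zero V hQ.symm
  have hy0 : y ≠ 0 := by
    intro h0
    apply hy
    rw [negY_of_isTwoTorsionNF, h0, neg_zero]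
  rw [Affine.Point.add_self_of_Y_ne hy, twoTorsionPoint, Affine.Point.some.injEq] at hQ
  have hdup := addX_self_mul V h hy
  rw [hQ.1, zero_mul] at hdup
  have : x ^ 2 - V.a₄ = 0 := pow_eq_zero_iff two_ne_zero |>.mp hdup.symm
  exact ⟨x, by linear_combination -this⟩
end NF

/-! ## §3. Over a finite field: `4 ∣ #V(𝔽)` iff `b` or `a² - 4b` is a square -/

section Finite
variable {F : Type*} [Field F] [Finite F] (V : WeierstrassCurve F) [V.IsTwoTorsionNF] [V.IsElliptic]

/-- In a finite field, if `u·v` is NOT a square then `u` or `v` is a square (the quadratic character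
is multiplicative and `(-1)·(-1) = 1`). [folklore] -/
theorem isSquare_or_isSquare_of_not_isSquare_mul {u v : F} (h : ¬ IsSquare (u * v)) :
    IsSquare u ∨ IsSquare v := by
  haveI := Fintype.ofFinite F
  by_contra hc
  push Not at hc
  have hu := (quadraticChar_neg_one_iff_not_isSquare (F := F)).mpr hc.1
  have hv := (quadraticChar_neg_one_iff_not_isSquare (F := F)).mpr hc.2
  have huv : quadraticChar F (u * v) = 1 := by rw [map_mul, hu, hv]; norm_num
  have huv0 : u * v ≠ 0 := fun h0 ↦ h (h0 ▸ IsSquare.zero)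
  exact h ((quadraticChar_one_iff_isSquare huv0).mp huv)

/-- **If `b` is a square, `4 ∣ #V(𝔽)`.** Write `b = s²`. If `a² - 4b` is a square this is
`four_dvd_natCard_point_of_isSquare_discr`; otherwise `(a + 2s)(a - 2s) = a² - 4b` is a non-square,
so one of `a ± 2s` is a square `w²` and `Q = (±s, ±sw)` halves `T` (`four_dvd_natCard_point_of_sq_eq`).
Knapp, *Elliptic Curves*, Thm. 4.2. [folklore] -/
theorem four_dvd_natCard_point_of_isSquare_a₄ (hb : IsSquare V.a₄) : 4 ∣ Nat.card V.toAffine.Point := by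
  by_cases hr : IsSquare (V.a₂ ^ 2 - 4 * V.a₄)
  · exact four_dvd_natCard_point_of_isSquare_discr V hr
  obtain ⟨s, hs⟩ := hb
  have hprod : (V.a₂ + 2 * s) * (V.a₂ - 2 * s) = V.a₂ ^ 2 - 4 * V.a₄ := by rw [hs]; ring
  rw [← hprod] at hr
  rcases isSquare_or_isSquare_of_not_isSquare_mul hr with ⟨w, hw⟩ | ⟨w, hw⟩
  · exact four_dvd_natCard_point_of_sq_eq V s w (by rw [hs, sq]) (by rw [hw, sq])
  · exact four_dvd_natCard_point_of_sq_eq V (-s) w (by rw [hs, neg_sq, sq])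
      (by linear_combination -hw)

/-- **`4 ∣ #V(𝔽)` iff `b` is a square or `a² - 4b` is a square** for an elliptic curve
`V : y² = x³ + ax² + bx` over a finite field (of odd characteristic, automatically): (⇐) by the two
previous theorems; (⇒) either `V(𝔽)` has a point of order `2` besides `T` — a root of `x² + ax + b`,
so `a² - 4b = (2x + a)²` — or `V(𝔽)[2] = {O, T}` and `T` is a double `Q + Q` (Cauchy in `2·V(𝔽)`),
whence `b = x(Q)²` by the duplication formula. Knapp, *Elliptic Curves*, Thm. 4.2; Silverman, *AEC*,
III.2.3(d), X.4.9. [folklore] -/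
theorem four_dvd_natCard_point_iff_isSquare :
    4 ∣ Nat.card V.toAffine.Point ↔ IsSquare V.a₄ ∨ IsSquare (V.a₂ ^ 2 - 4 * V.a₄) := by
  refine ⟨fun h4 ↦ ?_, fun h ↦ h.elim (four_dvd_natCard_point_of_isSquare_a₄ V)
    (four_dvd_natCard_point_of_isSquare_discr V)⟩
  haveI : Finite V.toAffine.Point := WeierstrassCurve.finite_point V
  rcases exists_two_torsion_or_exists_double h4 (twoTorsionPoint_ne_zero V)
      (twoTorsionPoint_add_twoTorsionPoint V) with ⟨P, hP0, hPT, hP2⟩ | ⟨Q, hQ⟩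
  · exact Or.inr (isSquare_discr_of_two_torsion V hP0 hPT hP2)
  · exact Or.inl (isSquare_a₄_of_double_eq_twoTorsionPoint V hQ)
end Finite

/-! ## §4. Square classes in a field -/

section SquareClass
variable {F : Type*} [Field F]

/-- `c²·a` is a square iff `a` is (`c ≠ 0`). [folklore] -/
theorem isSquare_sq_mul_iff {c : F} (hc : c ≠ 0) (a : F) : IsSquare (c ^ 2 * a) ↔ IsSquare a := by
  refine ⟨fun ⟨r, hr⟩ ↦ ⟨r / c, ?_⟩, fun ⟨r, hr⟩ ↦ ⟨c * r, by rw [hr]; ring⟩⟩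
  field_simp
  linear_combination hr

/-- Elements of the same square class: if `a·b = k²` with `a, b ≠ 0`, then `a` is a square iff `b`
is. [folklore] -/
theorem isSquare_iff_of_mul_eq_sq {a b k : F} (ha : a ≠ 0) (hb : b ≠ 0) (hk : a * b = k ^ 2) :
    IsSquare a ↔ IsSquare b := by
  have aux : ∀ {a b : F}, a ≠ 0 → a * b = k ^ 2 → IsSquare a → IsSquare b := by
    rintro a b ha hk ⟨r, hr⟩
    have hr0 : r ≠ 0 := by rintro rfl; exact ha (by simpa using hr)
    have hb' : b = k ^ 2 / r ^ 2 := by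
      rw [← hk, hr]
      field_simp
    exact ⟨k / r, by rw [hb']; ring⟩
  exact ⟨aux ha hk, aux hb (by rw [mul_comm, hk])⟩
end SquareClass

/-! ## §5. A rational point of order `2` on a globally minimal model: `4x ∈ ℤ` -/

section Rat
variable (W : WeierstrassCurve ℚ) [W.IsElliptic] [W.IsGloballyMinimal]

omit [W.IsElliptic] in
/-- A globally minimal `W/ℚ` is `ℤ`-integral in Mathlib's sense, with witness `integralModelInt W`.
[folklore] -/
theorem isIntegral_int : W.IsIntegral ℤ :=
  ⟨⟨integralModelInt W, by rw [baseChange, algebraMap_int_eq, map_integralModelInt]⟩⟩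

omit [W.IsGloballyMinimal] in
/-- A rational point of order `2` with abscissa `x` is a point of finite order of `E(ℚ)`.
[folklore] -/
theorem isOfFinAddOrder_of_twoTorsion {x y : ℚ} (hxy : W.toAffine.Equation x y)
    (h2 : 2 * y + W.a₁ * x + W.a₃ = 0) :
    IsOfFinAddOrder (.some x y ((Affine.equation_iff_nonsingular).mp hxy) : W.toAffine.Point) := by
  have hneg : y = W.toAffine.negY x y := by
    rw [Affine.negY]
    linear_combination h2
  exact isOfFinAddOrder_iff_nsmul_eq_zero.mpr
    ⟨2, two_pos, by rw [two_nsmul, Affine.Point.add_self_of_Y_eq hneg]⟩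

/-- **`4·x(P) ∈ ℤ` for a rational point `P` of order `2` on a globally minimal model** (Lutz–Nagell /
Knapp Thm. 5.1(b): `4x, 8y ∈ ℤ` for torsion points on a `ℤ`-integral equation; tree
`exists_int_eq_four_mul_eight_mul_of_isOfFinAddOrder`). [cite: Knapp1993, Ch. V §1 Thm. 5.1(b)] -/
theorem exists_int_eq_four_mul_of_hasRationalTwoTorsionX {x : ℚ} (hx : HasRationalTwoTorsionX W x) :
    ∃ m : ℤ, (m : ℚ) = 4 * x := by
  obtain ⟨y, hxy, h2⟩ := hx
  haveI := isIntegral_int W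
  obtain ⟨m, n, hm, -⟩ :=
    LutzNagellGeneral.exists_int_eq_four_mul_eight_mul_of_isOfFinAddOrder W
      (isOfFinAddOrder_of_twoTorsion W hxy h2)
  exact ⟨m, hm⟩
end Rat

end Summit.BirchSwinnertonDyer.BirchSwinnertonDyer.Theorems.TwoAdicTwistConverse

end
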